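import Mathlib.Analysis.SpecialFunctions.Gaussian.GaussianIntegral
import Mathlib.Analysis.Complex.Exponential
import Mathlib.MeasureTheory.Integral.IntervalIntegral.Basic
import Literature.Analysis.Fourier.GaussianMomentBound
import HarnessLib

/-!
# The saddle-point window at second order: `∫_{-τ}^{τ} e^{g(t)} A(t) dt = A₀ √(2π/φ) (1 + O(Φ₄/φ² + Φ₃²/φ³ + …))`

Topic `Literature/NumberTheory/Sieve`; a PROVED analytic tool toward Hildebrand–Tenenbaum's
saddle-point theorem for `Ψ(x, y)` [HildebrandTenenbaum1986, Thm 1 and Lemma 11]. The tree's window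
analysis (`SmoothRieszMeanKernel`, `SmoothSaddleKernel`) expands the saddle exponent to SECOND order,
`e(t) = -φt²/2 + O(|t|³ log y · φ)`, which costs a relative error `≍ φ₃/φ₂^{3/2} ≍ ū^{-1/2}`; the
precision `1 + O(1/ū)` of Theorem 1 needs the next order, where the cubic term `iΦ₃t³/6` is ODD and
integrates to zero against the Gaussian. This file is that bookkeeping, abstractly (no `ζ(s, y)` here):

* `integral_Icc_eq_zero_of_odd` — `∫_{[-τ,τ]} h = 0` for odd `h`;
* `pow_mul_exp_neg_le`, `integral_pow_mul_exp_neg_le` — Gaussian moments by the sup trick: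
  `t^{2m} e^{-φt²/4} ≤ (4m/(eφ))^m`, so `∫ t^{2m} e^{-φt²/2} dt ≤ (4m/(eφ))^m √(4π/φ)`;
* `norm_window_pointwise` — if `‖g(t) + φt²/2 - iΦ₃t³/6‖ ≤ Φ₄t⁴`, `Φ₃|t|³/6 + Φ₄t⁴ ≤ 1` and
  `‖A(t) - A₀ - A₁t‖ ≤ B₂t²`, then
  `‖e^{g(t)}A(t) - e^{-φt²/2}(A₀ + A₀ iΦ₃t³/6 + A₁t)‖ ≤ e^{-φt²/2}(c₂t² + c₄t⁴ + c₆t⁶ + c₈t⁸)` with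
  `c₂ = eB₂`, `c₄ = ‖A₀‖Φ₄ + ‖A₁‖(Φ₃/3 + Φ₄)`, `c₆ = ‖A₀‖Φ₃²/18 + ‖A₁‖Φ₄`, `c₈ = 2‖A₀‖Φ₄²`
  (`e^w = 1 + w + O(|w|²)` for `|w| ≤ 1`, `w = iΦ₃t³/6 + R(t)`);
* `norm_setIntegral_window_sub_main_le` — integrating such a pointwise bound over `[-τ, τ]`:
  `‖∫_{[-τ,τ]} F - A₀√(2π/φ)‖ ≤ ‖A₀‖ e^{-φτ²/4}√(4π/φ) + √(4π/φ) Σ_{m=1}^{4} c_{2m} (4m/(eφ))^m`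
  (the odd terms `A₀ iΦ₃ t³/6`, `A₁ t` contribute nothing).

With `Φ₃ ≍ φ^{3/2} ū^{-1/2}`, `Φ₄ ≍ φ² ū^{-1}` (op. cit. Lemma 4) every term is `O(‖A₀‖ φ^{-1/2} ū^{-1})`.

## References

* [HildebrandTenenbaum1986] A. Hildebrand, G. Tenenbaum, Trans. AMS 296 (1986) 265–290, §4,
  Lemma 11 and (4.5)–(4.8) (held: `paper:doi-10-1090-s0002-9947-1986-0837811-1`, pp. 279–282).
-/

noncomputable section

open Real Complex MeasureTheory Set Filter intervalIntegral

namespace Literature.NumberTheory.Sieve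

namespace SaddleWindow

variable {φ τ : ℝ}

/-! ### Odd integrands -/

/-- **Odd integrands vanish on symmetric intervals**: `∫_{[-τ, τ]} h = 0` when `h(-t) = -h(t)`.
[folklore] -/
theorem integral_Icc_eq_zero_of_odd {h : ℝ → ℂ} (τ : ℝ) (hodd : ∀ t, h (-t) = -h t) :
    ∫ t in Set.Icc (-τ) τ, h t = 0 := by
  rcases lt_or_ge τ 0 with hτ | hτ
  · rw [Set.Icc_eq_empty (by linarith), Measure.restrict_empty, integral_zero_measure]
  have hle : -τ ≤ τ := by linarith
  rw [integral_Icc_eq_integral_Ioc, ← intervalIntegral.integral_of_le hle]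
  have h1 : (∫ t in (-τ)..τ, h (-t)) = ∫ t in (-τ)..τ, h t := by
    rw [intervalIntegral.integral_comp_neg]; simp
  have h2 : (∫ t in (-τ)..τ, h (-t)) = -∫ t in (-τ)..τ, h t := by
    rw [← intervalIntegral.integral_neg]
    exact intervalIntegral.integral_congr fun t _ => hodd t
  have h3 : (∫ t in (-τ)..τ, h t) = -∫ t in (-τ)..τ, h t := h1.symm.trans h2
  linear_combination h3 / 2

/-! ### Gaussian moments by the sup trick -/

/-- `x e^{-x} ≤ e^{-1}` (`x ≤ e^{x-1}`, for every real `x`) — a duplicate of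
`Literature.Analysis.Fourier.mul_exp_neg_le_exp_neg_one` (`GaussianMomentBound`), kept as a
deprecated alias. [folklore] -/
@[deprecated Literature.Analysis.Fourier.mul_exp_neg_le_exp_neg_one (since := "2026-08-17")]
alias mul_exp_neg_le := Literature.Analysis.Fourier.mul_exp_neg_le_exp_neg_one

/-- **The sup trick**: `t^{2m} e^{-(φ/4)t²} ≤ (4m/(eφ))^m` (`m ≥ 1`, `φ > 0`; with `x = φt²/(4m)`,
the left side is `(4m/φ)^m (x e^{-x})^m`). [folklore] -/
theorem pow_mul_exp_neg_le {m : ℕ} (hm : 1 ≤ m) (hφ : 0 < φ) (t : ℝ) :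
    t ^ (2 * m) * Real.exp (-(φ / 4) * t ^ 2) ≤ (4 * m / (Real.exp 1 * φ)) ^ m := by
  have hm0 : (0 : ℝ) < m := by exact_mod_cast hm
  set x : ℝ := φ * t ^ 2 / (4 * m) with hx
  have hx0 : 0 ≤ x := by positivity
  have ht2 : t ^ 2 = 4 * m / φ * x := by rw [hx]; field_simp
  have h1 : t ^ (2 * m) = (4 * m / φ) ^ m * x ^ m := by rw [pow_mul, ht2, mul_pow]
  have h2 : Real.exp (-(φ / 4) * t ^ 2) = Real.exp (-x) ^ m := by
    rw [← Real.exp_nat_mul, ht2]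
    congr 1
    field_simp
  rw [h1, h2, mul_assoc, ← mul_pow]
  have h3 : x * Real.exp (-x) ≤ Real.exp (-1) :=
    Literature.Analysis.Fourier.mul_exp_neg_le_exp_neg_one x
  have h4 : (x * Real.exp (-x)) ^ m ≤ Real.exp (-1) ^ m := pow_le_pow_left₀ (by positivity) h3 m
  calc (4 * m / φ) ^ m * (x * Real.exp (-x)) ^ m ≤ (4 * m / φ) ^ m * Real.exp (-1) ^ m :=
        mul_le_mul_of_nonneg_left h4 (by positivity)
    _ = (4 * m / (Real.exp 1 * φ)) ^ m := by
        rw [← mul_pow]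
        congr 1
        rw [Real.exp_neg]
        field_simp

/-- `t ↦ t^{2m} e^{-(φ/2)t²}` is integrable (`φ > 0`). [folklore] -/
theorem integrable_pow_mul_exp_neg (m : ℕ) (hφ : 0 < φ) :
    Integrable fun t : ℝ => t ^ (2 * m) * Real.exp (-(φ / 2) * t ^ 2) := by
  rcases Nat.eq_zero_or_pos m with hm | hm
  · subst hm
    simpa using integrable_exp_neg_mul_sq (by positivity : 0 < φ / 2)
  have hK := fun t => pow_mul_exp_neg_le (φ := φ) hm hφ t
  set K : ℝ := (4 * m / (Real.exp 1 * φ)) ^ m with hKdef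
  have hint : Integrable fun t : ℝ => K * Real.exp (-(φ / 4) * t ^ 2) :=
    (integrable_exp_neg_mul_sq (by positivity : 0 < φ / 4)).const_mul K
  refine hint.mono' (by fun_prop) (Eventually.of_forall fun t => ?_)
  have h0 : 0 ≤ t ^ (2 * m) := by rw [pow_mul]; positivity
  rw [Real.norm_eq_abs, abs_of_nonneg (mul_nonneg h0 (Real.exp_pos _).le)]
  have hsplit : Real.exp (-(φ / 2) * t ^ 2) = Real.exp (-(φ / 4) * t ^ 2) * Real.exp (-(φ / 4) * t ^ 2) := by
    rw [← Real.exp_add]; ring_nf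
  rw [hsplit, ← mul_assoc]
  exact mul_le_mul_of_nonneg_right (hK t) (Real.exp_pos _).le

/-- **Gaussian moments**: `∫ t^{2m} e^{-(φ/2)t²} dt ≤ (4m/(eφ))^m √(4π/φ)` (`m ≥ 1`, `φ > 0`).
[folklore] -/
theorem integral_pow_mul_exp_neg_le {m : ℕ} (hm : 1 ≤ m) (hφ : 0 < φ) :
    ∫ t : ℝ, t ^ (2 * m) * Real.exp (-(φ / 2) * t ^ 2) ≤
      (4 * m / (Real.exp 1 * φ)) ^ m * Real.sqrt (4 * Real.pi / φ) := by
  set K : ℝ := (4 * m / (Real.exp 1 * φ)) ^ m with hKdef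
  have hint : Integrable fun t : ℝ => K * Real.exp (-(φ / 4) * t ^ 2) :=
    (integrable_exp_neg_mul_sq (by positivity : 0 < φ / 4)).const_mul K
  calc ∫ t : ℝ, t ^ (2 * m) * Real.exp (-(φ / 2) * t ^ 2) ≤ ∫ t : ℝ, K * Real.exp (-(φ / 4) * t ^ 2) := by
        refine integral_mono (integrable_pow_mul_exp_neg m hφ) hint fun t => ?_
        have hsplit : Real.exp (-(φ / 2) * t ^ 2) =
            Real.exp (-(φ / 4) * t ^ 2) * Real.exp (-(φ / 4) * t ^ 2) := by
          rw [← Real.exp_add]; ring_nf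
        dsimp only
        rw [hsplit, ← mul_assoc]
        exact mul_le_mul_of_nonneg_right (pow_mul_exp_neg_le hm hφ t) (Real.exp_pos _).le
    _ = K * Real.sqrt (4 * Real.pi / φ) := by
        rw [MeasureTheory.integral_const_mul, integral_gaussian]
        congr 2
        field_simp

/-- The Gaussian itself: `∫ e^{-(φ/2)t²} dt = √(2π/φ)`. [folklore] -/
theorem integral_exp_neg_half_mul_sq (hφ : 0 < φ) :
    ∫ t : ℝ, Real.exp (-(φ / 2) * t ^ 2) = Real.sqrt (2 * Real.pi / φ) := by
  rw [integral_gaussian]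
  congr 1
  field_simp

/-- **The Gaussian tail**: `∫_{[-τ,τ]ᶜ} e^{-(φ/2)t²} dt ≤ e^{-φτ²/4} √(4π/φ)` (`τ ≥ 0`). [folklore] -/
theorem setIntegral_compl_Icc_exp_neg_le (hτ : 0 ≤ τ) (hφ : 0 < φ) :
    ∫ t in (Set.Icc (-τ) τ)ᶜ, Real.exp (-(φ / 2) * t ^ 2) ≤
      Real.exp (-(φ / 4) * τ ^ 2) * Real.sqrt (4 * Real.pi / φ) := by
  have hgi : Integrable fun t : ℝ => Real.exp (-(φ / 2) * t ^ 2) :=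
    integrable_exp_neg_mul_sq (by positivity : 0 < φ / 2)
  have hg4 : Integrable fun t : ℝ => Real.exp (-(φ / 4) * τ ^ 2) * Real.exp (-(φ / 4) * t ^ 2) :=
    (integrable_exp_neg_mul_sq (by positivity : 0 < φ / 4)).const_mul _
  calc ∫ t in (Set.Icc (-τ) τ)ᶜ, Real.exp (-(φ / 2) * t ^ 2)
      ≤ ∫ t in (Set.Icc (-τ) τ)ᶜ, Real.exp (-(φ / 4) * τ ^ 2) * Real.exp (-(φ / 4) * t ^ 2) := by
        refine setIntegral_mono_on hgi.integrableOn hg4.integrableOn measurableSet_Icc.compl fun t ht => ?_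
        have ht2 : τ ^ 2 ≤ t ^ 2 := by
          rw [Set.mem_compl_iff, Set.mem_Icc, not_and_or, not_le, not_le] at ht
          rcases ht with h | h
          · have h1 : τ < -t := by linarith
            have := mul_self_lt_mul_self hτ h1
            nlinarith
          · have := mul_self_lt_mul_self hτ h
            nlinarith
        rw [← Real.exp_add]
        exact Real.exp_le_exp.2 (by nlinarith)
    _ ≤ ∫ t, Real.exp (-(φ / 4) * τ ^ 2) * Real.exp (-(φ / 4) * t ^ 2) :=
        setIntegral_le_integral hg4 (Eventually.of_forall fun t => by positivity)
    _ = Real.exp (-(φ / 4) * τ ^ 2) * Real.sqrt (4 * Real.pi / φ) := by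
        rw [MeasureTheory.integral_const_mul, integral_gaussian]
        congr 2
        field_simp

/-! ### The pointwise expansion -/

/-- **Pointwise second-order expansion of the window integrand.** If
`‖g(t) + φt²/2 - iΦ₃t³/6‖ ≤ Φ₄ t⁴`, `Φ₃|t|³/6 + Φ₄t⁴ ≤ 1` and `‖A(t) - A₀ - A₁t‖ ≤ B₂t²`, then with
`w = g(t) + φt²/2` (`|w| ≤ 1`, `e^w = 1 + w + O(|w|²)`),
`‖e^{g(t)} A(t) - e^{-φt²/2}(A₀ + A₀ iΦ₃t³/6 + A₁ t)‖ ≤ e^{-φt²/2}(c₂t² + c₄t⁴ + c₆t⁶ + c₈t⁸)`,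
`c₂ = eB₂`, `c₄ = ‖A₀‖Φ₄ + ‖A₁‖(Φ₃/3 + Φ₄)`, `c₆ = ‖A₀‖Φ₃²/18 + ‖A₁‖Φ₄`, `c₈ = 2‖A₀‖Φ₄²`.
[cite: HildebrandTenenbaum1986, §4 (4.5)–(4.7)] -/
theorem norm_window_pointwise {g A : ℝ → ℂ} {φ Φ₃ Φ₄ B₂ t : ℝ} {A₀ A₁ : ℂ}
    (hΦ₃ : 0 ≤ Φ₃) (hΦ₄ : 0 ≤ Φ₄)
    (hg : ‖g t + ((φ / 2 * t ^ 2 : ℝ) : ℂ) - ((Φ₃ / 6 * t ^ 3 : ℝ) : ℂ) * I‖ ≤ Φ₄ * t ^ 4)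
    (hsmall : Φ₃ / 6 * |t| ^ 3 + Φ₄ * t ^ 4 ≤ 1)
    (hA : ‖A t - A₀ - A₁ * t‖ ≤ B₂ * t ^ 2) :
    ‖Complex.exp (g t) * A t -
        ((Real.exp (-(φ / 2) * t ^ 2) : ℝ) : ℂ) * (A₀ + A₀ * (((Φ₃ / 6 * t ^ 3 : ℝ) : ℂ) * I) + A₁ * t)‖ ≤
      Real.exp (-(φ / 2) * t ^ 2) *
        (Real.exp 1 * B₂ * t ^ 2 + (‖A₀‖ * Φ₄ + ‖A₁‖ * (Φ₃ / 3 + Φ₄)) * t ^ 4 +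
          (‖A₀‖ * Φ₃ ^ 2 / 18 + ‖A₁‖ * Φ₄) * t ^ 6 + 2 * ‖A₀‖ * Φ₄ ^ 2 * t ^ 8) := by
  -- notation
  set G : ℝ := Real.exp (-(φ / 2) * t ^ 2) with hG
  have hG0 : 0 < G := Real.exp_pos _
  set c : ℂ := ((Φ₃ / 6 * t ^ 3 : ℝ) : ℂ) * I with hc
  set w : ℂ := g t + ((φ / 2 * t ^ 2 : ℝ) : ℂ) with hw
  set R : ℂ := w - c with hR
  set Q : ℂ := A t - A₀ - A₁ * t with hQ
  set W : ℝ := Φ₃ / 6 * |t| ^ 3 + Φ₄ * t ^ 4 with hW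
  have hW0 : 0 ≤ W := by positivity
  have hW1 : W ≤ 1 := hsmall
  -- `‖R‖ ≤ Φ₄ t⁴`, `‖c‖ = Φ₃|t|³/6`, `‖w‖ ≤ W ≤ 1`
  have hRn : ‖R‖ ≤ Φ₄ * t ^ 4 := by rw [hR, hw, hc]; exact hg
  have hcn : ‖c‖ = Φ₃ / 6 * |t| ^ 3 := by
    rw [hc, norm_mul, Complex.norm_I, mul_one, Complex.norm_real, Real.norm_eq_abs, abs_mul,
      abs_of_nonneg (by positivity : (0 : ℝ) ≤ Φ₃ / 6), abs_pow]
  have hwn : ‖w‖ ≤ W := by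
    have : w = c + R := by rw [hR]; ring
    rw [this]
    calc ‖c + R‖ ≤ ‖c‖ + ‖R‖ := norm_add_le _ _
      _ ≤ Φ₃ / 6 * |t| ^ 3 + Φ₄ * t ^ 4 := by rw [hcn]; linarith
  have hw1 : ‖w‖ ≤ 1 := hwn.trans hW1
  -- `e^{g} = G e^{w}`
  have hexp : Complex.exp (g t) = (G : ℂ) * Complex.exp w := by
    rw [hG, hw, Complex.ofReal_exp, ← Complex.exp_add]
    congr 1
    push_cast
    ring
  -- the algebraic decomposition
  have hdecomp : Complex.exp (g t) * A t - (G : ℂ) * (A₀ + A₀ * c + A₁ * t) =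
      (G : ℂ) * (Complex.exp w * Q + (Complex.exp w - 1 - w) * A₀ + R * A₀ + (Complex.exp w - 1) * (A₁ * t)) := by
    rw [hexp, hQ, hR]
    ring
  rw [hdecomp, norm_mul, Complex.norm_real, Real.norm_eq_abs, abs_of_pos hG0]
  refine mul_le_mul_of_nonneg_left ?_ hG0.le
  -- the four pieces
  have hexpw : ‖Complex.exp w‖ ≤ Real.exp 1 := by
    rw [Complex.norm_exp]
    exact Real.exp_le_exp.2 (le_trans (Complex.re_le_norm w) hw1)
  have h1 : ‖Complex.exp w * Q‖ ≤ Real.exp 1 * B₂ * t ^ 2 := by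
    rw [norm_mul, mul_assoc]
    exact mul_le_mul hexpw hA (norm_nonneg _) (Real.exp_pos 1).le
  have h2 : ‖(Complex.exp w - 1 - w) * A₀‖ ≤ W ^ 2 * ‖A₀‖ := by
    rw [norm_mul]
    refine mul_le_mul_of_nonneg_right ?_ (norm_nonneg _)
    exact (Complex.norm_exp_sub_one_sub_id_le hw1).trans (pow_le_pow_left₀ (norm_nonneg _) hwn 2)
  have h3 : ‖R * A₀‖ ≤ Φ₄ * t ^ 4 * ‖A₀‖ := by
    rw [norm_mul]; exact mul_le_mul_of_nonneg_right hRn (norm_nonneg _)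
  have h4 : ‖(Complex.exp w - 1) * (A₁ * t)‖ ≤ 2 * W * (‖A₁‖ * |t|) := by
    rw [norm_mul, norm_mul, Complex.norm_real, Real.norm_eq_abs]
    refine mul_le_mul_of_nonneg_right ?_ (by positivity)
    have : Complex.exp w - 1 = (Complex.exp w - 1 - w) + w := by ring
    rw [this]
    calc ‖Complex.exp w - 1 - w + w‖ ≤ ‖Complex.exp w - 1 - w‖ + ‖w‖ := norm_add_le _ _
      _ ≤ ‖w‖ ^ 2 + ‖w‖ := by linarith [Complex.norm_exp_sub_one_sub_id_le hw1]
      _ ≤ W ^ 2 + W := by nlinarith [norm_nonneg w]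
      _ ≤ 2 * W := by nlinarith
  -- elementary inequalities in `t`
  have ht0 : 0 ≤ |t| := abs_nonneg t
  have habs2 : |t| ^ 2 = t ^ 2 := sq_abs t
  have habs3t : |t| ^ 3 * |t| = t ^ 4 := by
    have : |t| ^ 3 * |t| = (|t| ^ 2) ^ 2 := by ring
    rw [this, habs2]; ring
  have habs6 : (|t| ^ 3) ^ 2 = t ^ 6 := by
    have : (|t| ^ 3) ^ 2 = (|t| ^ 2) ^ 3 := by ring
    rw [this, habs2]; ring
  have h5 : t ^ 4 * |t| ≤ (t ^ 4 + t ^ 6) / 2 := by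
    -- `2 t⁴|t| ≤ t⁴ + t⁶` iff `t⁴ (|t| - 1)² ≥ 0`... via `|t| = s`, `t⁴ = s⁴`, `t⁶ = s⁶`
    have hs4 : t ^ 4 = |t| ^ 4 := by rw [show (4 : ℕ) = 2 * 2 from rfl, pow_mul, pow_mul, habs2]
    have hs6 : t ^ 6 = |t| ^ 6 := by rw [show (6 : ℕ) = 2 * 3 from rfl, pow_mul, pow_mul, habs2]
    rw [hs4, hs6]
    nlinarith [pow_nonneg ht0 4, mul_self_nonneg (|t| - 1), pow_nonneg ht0 2]
  have hW2 : W ^ 2 ≤ 2 * ((Φ₃ / 6) ^ 2 * t ^ 6 + Φ₄ ^ 2 * t ^ 8) := by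
    rw [hW]
    have hab : ∀ a b : ℝ, (a + b) ^ 2 ≤ 2 * (a ^ 2 + b ^ 2) := fun a b => by nlinarith [sq_nonneg (a - b)]
    calc (Φ₃ / 6 * |t| ^ 3 + Φ₄ * t ^ 4) ^ 2 ≤ 2 * ((Φ₃ / 6 * |t| ^ 3) ^ 2 + (Φ₄ * t ^ 4) ^ 2) := hab _ _
      _ = 2 * ((Φ₃ / 6) ^ 2 * t ^ 6 + Φ₄ ^ 2 * t ^ 8) := by rw [mul_pow, habs6]; ring
  have hWt : W * |t| ≤ Φ₃ / 6 * t ^ 4 + Φ₄ * ((t ^ 4 + t ^ 6) / 2) := by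
    rw [hW, add_mul, mul_assoc, habs3t, mul_assoc]
    gcongr
  calc ‖Complex.exp w * Q + (Complex.exp w - 1 - w) * A₀ + R * A₀ + (Complex.exp w - 1) * (A₁ * t)‖
      ≤ ‖Complex.exp w * Q + (Complex.exp w - 1 - w) * A₀ + R * A₀‖ + ‖(Complex.exp w - 1) * (A₁ * t)‖ :=
        norm_add_le _ _
    _ ≤ ‖Complex.exp w * Q + (Complex.exp w - 1 - w) * A₀‖ + ‖R * A₀‖ + ‖(Complex.exp w - 1) * (A₁ * t)‖ := by
        gcongr; exact norm_add_le _ _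
    _ ≤ ‖Complex.exp w * Q‖ + ‖(Complex.exp w - 1 - w) * A₀‖ + ‖R * A₀‖ + ‖(Complex.exp w - 1) * (A₁ * t)‖ := by
        gcongr; exact norm_add_le _ _
    _ ≤ Real.exp 1 * B₂ * t ^ 2 + W ^ 2 * ‖A₀‖ + Φ₄ * t ^ 4 * ‖A₀‖ + 2 * W * (‖A₁‖ * |t|) := by
        linarith [h1, h2, h3, h4]
    _ = Real.exp 1 * B₂ * t ^ 2 + ‖A₀‖ * W ^ 2 + ‖A₀‖ * Φ₄ * t ^ 4 + 2 * ‖A₁‖ * (W * |t|) := by ring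
    _ ≤ Real.exp 1 * B₂ * t ^ 2 + ‖A₀‖ * (2 * ((Φ₃ / 6) ^ 2 * t ^ 6 + Φ₄ ^ 2 * t ^ 8)) + ‖A₀‖ * Φ₄ * t ^ 4 +
          2 * ‖A₁‖ * (Φ₃ / 6 * t ^ 4 + Φ₄ * ((t ^ 4 + t ^ 6) / 2)) := by
        gcongr
    _ = Real.exp 1 * B₂ * t ^ 2 + (‖A₀‖ * Φ₄ + ‖A₁‖ * (Φ₃ / 3 + Φ₄)) * t ^ 4 +
          (‖A₀‖ * Φ₃ ^ 2 / 18 + ‖A₁‖ * Φ₄) * t ^ 6 + 2 * ‖A₀‖ * Φ₄ ^ 2 * t ^ 8 := by ring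

/-! ### Integration over the window -/

/-- The main (even + odd) model integrand `e^{-φt²/2}(A₀ + A₀ iΦ₃t³/6 + A₁t)` is continuous. [folklore] -/
theorem continuous_model (φ Φ₃ : ℝ) (A₀ A₁ : ℂ) :
    Continuous fun t : ℝ =>
      ((Real.exp (-(φ / 2) * t ^ 2) : ℝ) : ℂ) * (A₀ + A₀ * (((Φ₃ / 6 * t ^ 3 : ℝ) : ℂ) * I) + A₁ * t) := by
  fun_prop

/-- The odd part `e^{-φt²/2}(A₀ iΦ₃t³/6 + A₁t)` integrates to zero over `[-τ, τ]`. [folklore] -/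
theorem setIntegral_Icc_odd_part (φ Φ₃ τ : ℝ) (A₀ A₁ : ℂ) :
    ∫ t in Set.Icc (-τ) τ,
      ((Real.exp (-(φ / 2) * t ^ 2) : ℝ) : ℂ) * (A₀ * (((Φ₃ / 6 * t ^ 3 : ℝ) : ℂ) * I) + A₁ * t) = 0 := by
  refine integral_Icc_eq_zero_of_odd τ fun t => ?_
  have h1 : (-t) ^ 2 = t ^ 2 := by ring
  have h2 : (-t) ^ 3 = -t ^ 3 := by ring
  rw [h1, h2]
  push_cast
  ring

/-- **The window integral at second order.** If `F` is integrable on `[-τ, τ]` and there satisfies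
`‖F(t) - e^{-φt²/2}(A₀ + A₀ iΦ₃t³/6 + A₁t)‖ ≤ e^{-φt²/2}(c₂t² + c₄t⁴ + c₆t⁶ + c₈t⁸)`, then
`‖∫_{[-τ,τ]} F - A₀ √(2π/φ)‖ ≤ ‖A₀‖ e^{-φτ²/4} √(4π/φ) + √(4π/φ) Σ_{m=1}^{4} c_{2m} (4m/(eφ))^m`:
the odd terms integrate to zero (`setIntegral_Icc_odd_part`), the Gaussian to `√(2π/φ)` up to the tail,
and the error by the moments `integral_pow_mul_exp_neg_le`. [cite: HildebrandTenenbaum1986, §4 (4.8)] -/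
theorem norm_setIntegral_window_sub_main_le {F : ℝ → ℂ} {φ Φ₃ τ c₂ c₄ c₆ c₈ : ℝ} {A₀ A₁ : ℂ}
    (hφ : 0 < φ) (hτ : 0 ≤ τ) (hc₂ : 0 ≤ c₂) (hc₄ : 0 ≤ c₄) (hc₆ : 0 ≤ c₆) (hc₈ : 0 ≤ c₈)
    (hF : IntegrableOn F (Set.Icc (-τ) τ))
    (hpt : ∀ t ∈ Set.Icc (-τ) τ, ‖F t -
        ((Real.exp (-(φ / 2) * t ^ 2) : ℝ) : ℂ) * (A₀ + A₀ * (((Φ₃ / 6 * t ^ 3 : ℝ) : ℂ) * I) + A₁ * t)‖ ≤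
      Real.exp (-(φ / 2) * t ^ 2) * (c₂ * t ^ 2 + c₄ * t ^ 4 + c₆ * t ^ 6 + c₈ * t ^ 8)) :
    ‖(∫ t in Set.Icc (-τ) τ, F t) - A₀ * ((Real.sqrt (2 * Real.pi / φ) : ℝ) : ℂ)‖ ≤
      ‖A₀‖ * (Real.exp (-(φ / 4) * τ ^ 2) * Real.sqrt (4 * Real.pi / φ)) +
        Real.sqrt (4 * Real.pi / φ) *
          (c₂ * (4 * 1 / (Real.exp 1 * φ)) ^ 1 + c₄ * (4 * 2 / (Real.exp 1 * φ)) ^ 2 +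
            c₆ * (4 * 3 / (Real.exp 1 * φ)) ^ 3 + c₈ * (4 * 4 / (Real.exp 1 * φ)) ^ 4) := by
  set S := Set.Icc (-τ) τ with hS
  have hSm : MeasurableSet S := measurableSet_Icc
  -- the pieces of the model
  set Mn : ℝ → ℂ := fun t =>
    ((Real.exp (-(φ / 2) * t ^ 2) : ℝ) : ℂ) * (A₀ + A₀ * (((Φ₃ / 6 * t ^ 3 : ℝ) : ℂ) * I) + A₁ * t) with hMn
  set Ev : ℝ → ℂ := fun t => ((Real.exp (-(φ / 2) * t ^ 2) : ℝ) : ℂ) * A₀ with hEv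
  set Od : ℝ → ℂ := fun t =>
    ((Real.exp (-(φ / 2) * t ^ 2) : ℝ) : ℂ) * (A₀ * (((Φ₃ / 6 * t ^ 3 : ℝ) : ℂ) * I) + A₁ * t) with hOd
  set P : ℝ → ℝ := fun t => Real.exp (-(φ / 2) * t ^ 2) * (c₂ * t ^ 2 + c₄ * t ^ 4 + c₆ * t ^ 6 + c₈ * t ^ 8)
    with hP
  have hgauss : Integrable fun t : ℝ => Real.exp (-(φ / 2) * t ^ 2) :=
    integrable_exp_neg_mul_sq (by positivity : 0 < φ / 2)
  have hEv_int : Integrable Ev := by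
    have h := (hgauss.ofReal (𝕜 := ℂ)).mul_const A₀
    exact h
  have hMn_cont : Continuous Mn := continuous_model φ Φ₃ A₀ A₁
  have hOd_cont : Continuous Od := by simp only [hOd]; fun_prop
  have hMn_int : IntegrableOn Mn S := hMn_cont.continuousOn.integrableOn_compact isCompact_Icc
  have hOd_int : IntegrableOn Od S := hOd_cont.continuousOn.integrableOn_compact isCompact_Icc
  have hMn_split : ∀ t, Mn t = Ev t + Od t := fun t => by simp only [hMn, hEv, hOd]; ring
  -- `∫_S Mn = A₀ ∫_S e^{-φt²/2}`
  have hOd0 : ∫ t in S, Od t = 0 := setIntegral_Icc_odd_part φ Φ₃ τ A₀ A₁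
  have hMnS : ∫ t in S, Mn t = (∫ t in S, ((Real.exp (-(φ / 2) * t ^ 2) : ℝ) : ℂ)) * A₀ := by
    calc ∫ t in S, Mn t = ∫ t in S, (Ev t + Od t) := by simp_rw [hMn_split]
      _ = (∫ t in S, Ev t) + ∫ t in S, Od t := integral_add hEv_int.integrableOn hOd_int
      _ = ∫ t in S, Ev t := by rw [hOd0, add_zero]
      _ = (∫ t in S, ((Real.exp (-(φ / 2) * t ^ 2) : ℝ) : ℂ)) * A₀ := by
          simp only [hEv]; exact integral_mul_const A₀ _
  -- the Gaussian over `S`: total minus tail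
  have hGS : (∫ t in S, ((Real.exp (-(φ / 2) * t ^ 2) : ℝ) : ℂ)) =
      (((∫ t in S, Real.exp (-(φ / 2) * t ^ 2)) : ℝ) : ℂ) := integral_ofReal
  have htot : (∫ t in S, Real.exp (-(φ / 2) * t ^ 2)) + ∫ t in Sᶜ, Real.exp (-(φ / 2) * t ^ 2) =
      Real.sqrt (2 * Real.pi / φ) := by
    rw [integral_add_compl hSm hgauss, integral_exp_neg_half_mul_sq hφ]
  have htail := setIntegral_compl_Icc_exp_neg_le hτ hφ
  have htail0 : 0 ≤ ∫ t in Sᶜ, Real.exp (-(φ / 2) * t ^ 2) :=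
    setIntegral_nonneg hSm.compl fun t _ => (Real.exp_pos _).le
  -- the error integral
  have hP_int : Integrable P := by
    have h2 := (integrable_pow_mul_exp_neg 1 hφ).const_mul c₂
    have h4 := (integrable_pow_mul_exp_neg 2 hφ).const_mul c₄
    have h6 := (integrable_pow_mul_exp_neg 3 hφ).const_mul c₆
    have h8 := (integrable_pow_mul_exp_neg 4 hφ).const_mul c₈
    have h := ((h2.add h4).add h6).add h8
    refine h.congr (Eventually.of_forall fun t => ?_)
    simp only [hP, Pi.add_apply]
    ring_nf
  have hP_nonneg : ∀ t, 0 ≤ P t := fun t => by simp only [hP]; positivity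
  have hPS : ∫ t in S, P t ≤ Real.sqrt (4 * Real.pi / φ) *
      (c₂ * (4 * 1 / (Real.exp 1 * φ)) ^ 1 + c₄ * (4 * 2 / (Real.exp 1 * φ)) ^ 2 +
        c₆ * (4 * 3 / (Real.exp 1 * φ)) ^ 3 + c₈ * (4 * 4 / (Real.exp 1 * φ)) ^ 4) := by
    have hm1 := integral_pow_mul_exp_neg_le (m := 1) le_rfl hφ
    have hm2 := integral_pow_mul_exp_neg_le (m := 2) (by norm_num) hφ
    have hm3 := integral_pow_mul_exp_neg_le (m := 3) (by norm_num) hφ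
    have hm4 := integral_pow_mul_exp_neg_le (m := 4) (by norm_num) hφ
    calc ∫ t in S, P t ≤ ∫ t, P t := setIntegral_le_integral hP_int (Eventually.of_forall hP_nonneg)
      _ = c₂ * (∫ t : ℝ, t ^ (2 * 1) * Real.exp (-(φ / 2) * t ^ 2)) +
            c₄ * (∫ t : ℝ, t ^ (2 * 2) * Real.exp (-(φ / 2) * t ^ 2)) +
            c₆ * (∫ t : ℝ, t ^ (2 * 3) * Real.exp (-(φ / 2) * t ^ 2)) +
            c₈ * (∫ t : ℝ, t ^ (2 * 4) * Real.exp (-(φ / 2) * t ^ 2)) := by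
          have h2 := (integrable_pow_mul_exp_neg 1 hφ).const_mul c₂
          have h4 := (integrable_pow_mul_exp_neg 2 hφ).const_mul c₄
          have h6 := (integrable_pow_mul_exp_neg 3 hφ).const_mul c₆
          have h8 := (integrable_pow_mul_exp_neg 4 hφ).const_mul c₈
          have h24 : Integrable fun t : ℝ => c₂ * (t ^ (2 * 1) * Real.exp (-(φ / 2) * t ^ 2)) +
              c₄ * (t ^ (2 * 2) * Real.exp (-(φ / 2) * t ^ 2)) := h2.add h4
          have h246 : Integrable fun t : ℝ => c₂ * (t ^ (2 * 1) * Real.exp (-(φ / 2) * t ^ 2)) +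
              c₄ * (t ^ (2 * 2) * Real.exp (-(φ / 2) * t ^ 2)) + c₆ * (t ^ (2 * 3) * Real.exp (-(φ / 2) * t ^ 2)) :=
            h24.add h6
          have e1 : ∫ t, P t = ∫ t : ℝ, (c₂ * (t ^ (2 * 1) * Real.exp (-(φ / 2) * t ^ 2)) +
              c₄ * (t ^ (2 * 2) * Real.exp (-(φ / 2) * t ^ 2)) + c₆ * (t ^ (2 * 3) * Real.exp (-(φ / 2) * t ^ 2)) +
              c₈ * (t ^ (2 * 4) * Real.exp (-(φ / 2) * t ^ 2))) := by
            refine integral_congr_ae (Eventually.of_forall fun t => ?_)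
            simp only [hP]
            ring_nf
          rw [e1, integral_add h246 h8, integral_add h24 h6, integral_add h2 h4, MeasureTheory.integral_const_mul,
            MeasureTheory.integral_const_mul, MeasureTheory.integral_const_mul, MeasureTheory.integral_const_mul]
      _ ≤ c₂ * ((4 * (1 : ℕ) / (Real.exp 1 * φ)) ^ 1 * Real.sqrt (4 * Real.pi / φ)) +
            c₄ * ((4 * (2 : ℕ) / (Real.exp 1 * φ)) ^ 2 * Real.sqrt (4 * Real.pi / φ)) +
            c₆ * ((4 * (3 : ℕ) / (Real.exp 1 * φ)) ^ 3 * Real.sqrt (4 * Real.pi / φ)) +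
            c₈ * ((4 * (4 : ℕ) / (Real.exp 1 * φ)) ^ 4 * Real.sqrt (4 * Real.pi / φ)) := by
          gcongr
      _ = _ := by push_cast; ring
  -- assemble
  have hdiff_int : IntegrableOn (fun t => F t - Mn t) S := hF.sub hMn_int
  have herr : ‖∫ t in S, (F t - Mn t)‖ ≤ ∫ t in S, P t := by
    calc ‖∫ t in S, (F t - Mn t)‖ ≤ ∫ t in S, ‖F t - Mn t‖ := norm_integral_le_integral_norm _
      _ ≤ ∫ t in S, P t := setIntegral_mono_on hdiff_int.norm hP_int.integrableOn hSm fun t ht => hpt t ht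
  have hsplitF : (∫ t in S, F t) = (∫ t in S, (F t - Mn t)) + ∫ t in S, Mn t := by
    rw [← integral_add hdiff_int hMn_int]
    refine integral_congr_ae (Eventually.of_forall fun t => ?_)
    simp
  have hmain : (∫ t in S, Mn t) - A₀ * ((Real.sqrt (2 * Real.pi / φ) : ℝ) : ℂ) =
      -A₀ * (((∫ t in Sᶜ, Real.exp (-(φ / 2) * t ^ 2)) : ℝ) : ℂ) := by
    rw [hMnS, hGS, ← htot]
    push_cast
    ring
  calc ‖(∫ t in S, F t) - A₀ * ((Real.sqrt (2 * Real.pi / φ) : ℝ) : ℂ)‖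
      = ‖(∫ t in S, (F t - Mn t)) + ((∫ t in S, Mn t) - A₀ * ((Real.sqrt (2 * Real.pi / φ) : ℝ) : ℂ))‖ := by
        rw [hsplitF]; ring_nf
    _ ≤ ‖∫ t in S, (F t - Mn t)‖ + ‖(∫ t in S, Mn t) - A₀ * ((Real.sqrt (2 * Real.pi / φ) : ℝ) : ℂ)‖ :=
        norm_add_le _ _
    _ ≤ (∫ t in S, P t) + ‖A₀‖ * ∫ t in Sᶜ, Real.exp (-(φ / 2) * t ^ 2) := by
        refine add_le_add herr ?_
        rw [hmain, norm_mul, norm_neg, Complex.norm_real, Real.norm_eq_abs, abs_of_nonneg htail0]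
    _ ≤ _ := by
        rw [add_comm]
        exact add_le_add (mul_le_mul_of_nonneg_left htail (norm_nonneg _)) hPS

end SaddleWindow

end Literature.NumberTheory.Sieve
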